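import Summits.ResolutionOfSingularities.ResolutionOfSingularities.Theses.SectionAscent
import Summits.ResolutionOfSingularities.ResolutionOfSingularities.Theorems.AffineToGlobal.Negative.CentreNotUnique
import Literature.AlgebraicGeometry.Resolution.AffineBlowupUniversal
import Literature.AlgebraicGeometry.Resolution.AffineBlowupAlgebra

/-!
# `AffineToGlobal` — negative lemmas IV-a: the chart of the point blowing up of a monomial curve
# embeds in `K[X]` (toolkit for "the reduced singular point is not a one-shot centre")

Support (negative-side) lemmas for crux `stmt-ResolutionOfSingularities-15961`
(`Summit.ResolutionOfSingularities.ResolutionOfSingularities.Theses.SectionAscent.AffineToGlobal`),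
filed by the crux disprover (cdisprove, gen 2, 2026-08-17); consumed by negative lemmas IV-b
(`PointBlowupNotRegular.lean`: `Bl_origin(Spec K[X², X⁵])` is not regular, so the reduced
singular locus — the one canonical, globally defined candidate centre a gluing proof of
`AffineToGlobal` could use — is not a one-shot centre). Setting: a domain `A` with an injective
ring map `ι : A → K[X]` killing the coefficients of `X¹` and `X³` (as for `A = K[X², X⁵]`),
elements `x₂, x₅ ∈ A` over `X², X⁵`, and the ideal `𝔭` generated by them (the origin).

* `coeff_one_three_eq_zero_of_mem` — elements of `K[X², X⁵]` have no `X¹` and no `X³` term.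
* `not_isRegularLocalRing_origin_of_coeff_one_eq_zero'` — variant of negative lemmas II with
  `X^(2k+3)` in place of `X³` (so that it applies to `K[X², X⁵]` itself): such an `A` containing
  `X²` and `X^(2k+3)` is not regular at the origin (a regular local ring is integrally closed, but
  `X = X^(2k+3)/X^(2k+2)` is integral and not of the form `a/s`, `s(0) ≠ 0` — compare linear
  coefficients).
* `coeff_eq_zero_of_mem_pow` — the filtration bookkeeping: `a ∈ 𝔭ⁿ` maps to a polynomial with no
  term of degree `< 2n` and none of degree `2n + 1`.
* `exists_chart_ringHom` — **the `x₂`-chart ring `(A[𝔭t])_{(x₂t)}` of `Bl_𝔭(Spec A)` embeds in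
  `K[X]`** (universal property of the Rees algebra, `exists_ringHom_reesAlgebra`, since
  `𝔭·K[X] = (X²)`; injective because every element is `a/x₂ᵐ`, `a ∈ 𝔭ᵐ`, and `x₂` is a unit of
  `A[1/x₂] ⊇ chart ring), with image free of linear terms and containing `X² = x₂/1` and
  `X³ = x₅t/x₂t` — i.e. the chart "is" the cuspidal cubic `K[X², X³]`.

No definition is declared; no declaration concludes a route decl positively.

## Sources
* U. Görtz, T. Wedhorn, *Algebraic Geometry I*, Prop. 13.92 (charts `A[I/f]` and their universal
  property), as proved in the tree (`exists_ringHom_reesAlgebra`); Stacks 0804.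
* H. Matsumura, *Commutative Ring Theory*, Thm. 19.4 (regular ⇒ normal), as proved in the tree.
-/

noncomputable section

set_option linter.dupNamespace false -- mandated namespace of this single-conjunct summit

open CategoryTheory AlgebraicGeometry Polynomial HomogeneousLocalization
open Literature.AlgebraicGeometry.Resolution
open Summit.ResolutionOfSingularities.ResolutionOfSingularities.Theses.SectionAscent (AffineToGlobal)

namespace Summit.ResolutionOfSingularities.ResolutionOfSingularities.Theorems.AffineToGlobal.Negative

section Charts

variable (K : Type) [Field K]

/-! ## The monomial curve `K[X², X⁵]` and its origin -/

/-- Elements of `K[X², X⁵]` have vanishing coefficients in degrees `1` and `3` (the numerical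
semigroup `⟨2, 5⟩` misses `1` and `3`). [folklore] -/
theorem coeff_one_three_eq_zero_of_mem {f : K[X]}
    (hf : f ∈ Algebra.adjoin K ({X ^ 2, X ^ 5} : Set K[X])) : f.coeff 1 = 0 ∧ f.coeff 3 = 0 := by
  induction hf using Algebra.adjoin_induction with
  | mem x hx =>
    simp only [Set.mem_insert_iff, Set.mem_singleton_iff] at hx
    rcases hx with rfl | rfl <;> simp [Polynomial.coeff_X_pow]
  | algebraMap c => simp
  | add x y _ _ hx hy => simp [hx.1, hx.2, hy.1, hy.2]
  | mul x y _ _ hx hy =>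
    constructor
    · rw [Polynomial.coeff_mul, Finset.Nat.sum_antidiagonal_eq_sum_range_succ_mk,
        Finset.sum_range_succ, Finset.sum_range_succ, Finset.sum_range_zero]
      simp [hx.1, hy.1]
    · rw [Polynomial.coeff_mul, Finset.Nat.sum_antidiagonal_eq_sum_range_succ_mk,
        Finset.sum_range_succ, Finset.sum_range_succ, Finset.sum_range_succ,
        Finset.sum_range_succ, Finset.sum_range_zero]
      simp [hx.1, hx.2, hy.1, hy.2]

/-- **A domain embedded in `K[X]` without linear terms and containing `X²`, `X^(2k+3)` is not
regular at the origin** (variant of `not_isRegularLocalRing_origin_of_coeff_one_eq_zero` with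
`X^(2k+3)` for `X³`): if the local ring at the origin were regular it would be integrally closed;
`u = X^(2k+3)/(X²)^(k+1) = X` has `u² = X²` in it, so `u = a/s` with `s(0) ≠ 0`, and
`a = sX` compares a vanishing linear coefficient with `s(0)`. [cite: Matsumura1987, Thm. 19.4] -/
theorem not_isRegularLocalRing_origin_of_coeff_one_eq_zero' {A : Type} [CommRing A] [IsDomain A]
    (ι : A →+* K[X]) (hι : Function.Injective ι) (hA : ∀ a : A, (ι a).coeff 1 = 0)
    (x₂ w : A) (k : ℕ) (hx₂ : ι x₂ = X ^ 2) (hw : ι w = X ^ (2 * k + 3))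
    (𝔭 : PrimeSpectrum A) (h𝔭 : ∀ a : A, a ∈ 𝔭.asIdeal ↔ (ι a).coeff 0 = 0) :
    ¬ IsRegularLocalRing (Localization.AtPrime 𝔭.asIdeal) := by
  intro hreg
  have hic : IsIntegrallyClosed (Localization.AtPrime 𝔭.asIdeal) :=
    isIntegrallyClosed_of_isRegularLocalRing _
  -- `w² = x₂^(2k+3)`
  have hx : w * w = x₂ ^ (2 * k + 3) := hι (by
    simp only [map_mul, map_pow, hx₂, hw]; ring)
  have hx₂0 : x₂ ≠ 0 := by
    intro h
    have h' : (X ^ 2 : K[X]) = 0 := by rw [← hx₂, h, map_zero]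
    exact pow_ne_zero 2 Polynomial.X_ne_zero h'
  have hM : 𝔭.asIdeal.primeCompl ≤ nonZeroDivisors A := 𝔭.asIdeal.primeCompl_le_nonZeroDivisors
  have hinjL := IsLocalization.injective (Localization.AtPrime 𝔭.asIdeal) hM
  have hinjA := IsFractionRing.injective A (FractionRing A)
  have hinjF := IsFractionRing.injective (Localization.AtPrime 𝔭.asIdeal) (FractionRing A)
  set a₂ : FractionRing A := algebraMap A (FractionRing A) x₂ with ha₂
  set aw : FractionRing A := algebraMap A (FractionRing A) w with haw
  have ha₂0 : a₂ ≠ 0 := by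
    rw [ha₂, map_ne_zero_iff _ hinjA]
    exact hx₂0
  have hx' : aw * aw = a₂ ^ (2 * k + 3) := by
    simp only [ha₂, haw, ← map_mul, ← map_pow, hx]
  -- `u = X^(2k+3)/X^(2k+2)` has `u² = X²`
  set u : FractionRing A := aw / a₂ ^ (k + 1) with hu
  have hu2 : u ^ 2 = a₂ := by
    rw [hu, div_pow, pow_two aw, hx', ← pow_mul]
    have : a₂ ^ (2 * k + 3) = a₂ * a₂ ^ ((k + 1) * 2) := by ring
    rw [this]
    field_simp
  have hint : IsIntegral (Localization.AtPrime 𝔭.asIdeal) (u ^ 2) := by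
    rw [hu2, ha₂, IsScalarTower.algebraMap_apply A (Localization.AtPrime 𝔭.asIdeal) (FractionRing A)]
    exact isIntegral_algebraMap
  obtain ⟨y, hy⟩ := IsIntegrallyClosed.exists_algebraMap_eq_of_isIntegral_pow two_pos hint
  -- `y · X^(2k+2) = X^(2k+3)` in the local ring
  have hyx : y * algebraMap A (Localization.AtPrime 𝔭.asIdeal) (x₂ ^ (k + 1)) =
      algebraMap A (Localization.AtPrime 𝔭.asIdeal) w := by
    apply hinjF
    rw [map_mul, hy, ← IsScalarTower.algebraMap_apply, ← IsScalarTower.algebraMap_apply, map_pow,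
      ← ha₂, ← haw, hu, div_mul_cancel₀ aw (pow_ne_zero _ ha₂0)]
  obtain ⟨⟨a, s⟩, has⟩ := IsLocalization.surj 𝔭.asIdeal.primeCompl y
  -- `a · X^(2k+2) = s · X^(2k+3)` in `A`
  have heq : a * x₂ ^ (k + 1) = (s : A) * w := by
    apply hinjL
    rw [map_mul, map_mul, ← has, mul_assoc,
      mul_comm (algebraMap A (Localization.AtPrime 𝔭.asIdeal) (s : A)), ← mul_assoc, hyx,
      mul_comm]
  have heq' : ι a * X ^ (2 * (k + 1)) = ι (s : A) * X * X ^ (2 * (k + 1)) := by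
    have h' : ι a * (X ^ 2) ^ (k + 1) = ι (s : A) * X ^ (2 * k + 3) := by
      rw [← hx₂, ← hw, ← map_pow, ← map_mul, ← map_mul, heq]
    rw [← pow_mul] at h'
    rw [h']
    ring
  have heq'' : ι a = ι (s : A) * X :=
    mul_right_cancel₀ (pow_ne_zero _ Polynomial.X_ne_zero) heq'
  have h1 : (ι a).coeff 1 = (ι (s : A)).coeff 0 := by
    rw [heq'', Polynomial.coeff_mul_X]
  have hs0 : (ι (s : A)).coeff 0 ≠ 0 := fun h0 => s.2 ((h𝔭 _).mpr h0)
  exact hs0 (h1 ▸ hA a)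

/-! ## Generic form: a domain `A ↪ K[X]` spanned like `K[X², X⁵]` near the origin -/

/-- **The filtration bookkeeping**: if `A → K[X]` kills the coefficients of `X¹` and `X³`, and
the ideal `𝔭` is generated by preimages `x₂, x₅` of `X², X⁵`, then an element of `𝔭ⁿ` maps to a
polynomial with no term of degree `< 2n` and no term of degree `2n + 1`. [folklore] -/
theorem coeff_eq_zero_of_mem_pow {A : Type} [CommRing A] (ι : A →+* K[X])
    (hA : ∀ a : A, (ι a).coeff 1 = 0 ∧ (ι a).coeff 3 = 0)
    (x₂ x₅ : A) (hx₂ : ι x₂ = X ^ 2) (hx₅ : ι x₅ = X ^ 5)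
    (𝔭 : Ideal A) (hgen : ∀ m ∈ 𝔭, ∃ b c : A, b * x₂ + c * x₅ = m)
    (n : ℕ) (a : A) (ha : a ∈ 𝔭 ^ n) :
    (∀ j < 2 * n, (ι a).coeff j = 0) ∧ (ι a).coeff (2 * n + 1) = 0 := by
  induction n generalizing a with
  | zero =>
    refine ⟨fun j hj => ?_, ?_⟩
    · simp at hj
    · simpa using (hA a).1
  | succ n ih =>
    rw [pow_succ] at ha
    refine Submodule.mul_induction_on
      (C := fun a : A => (∀ j < 2 * (n + 1), (ι a).coeff j = 0) ∧ (ι a).coeff (2 * (n + 1) + 1) = 0)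
      ha ?_ ?_
    · intro r hr m hm
      obtain ⟨hr1, hr2⟩ := ih r hr
      -- `m ∈ 𝔭`: `m = b x₂ + c x₅`
      obtain ⟨b, c, hbc⟩ := hgen m hm
      have hmval : ι m = ι b * X ^ 2 + ι c * X ^ 5 := by
        rw [← hbc, map_add, map_mul, map_mul, hx₂, hx₅]
      have hm_lt : ∀ l < 2, (ι m).coeff l = 0 := by
        intro l hl
        rw [hmval, Polynomial.coeff_add, Polynomial.coeff_mul_X_pow', Polynomial.coeff_mul_X_pow',
          if_neg (by omega), if_neg (by omega), add_zero]
      have hm3 : (ι m).coeff 3 = 0 := by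
        rw [hmval, Polynomial.coeff_add, Polynomial.coeff_mul_X_pow', Polynomial.coeff_mul_X_pow',
          if_pos (by norm_num), if_neg (by norm_num), add_zero]
        exact (hA b).1
      constructor
      · intro j hj
        rw [map_mul, Polynomial.coeff_mul]
        apply Finset.sum_eq_zero
        rintro ⟨i, l⟩ hil
        have hil' : i + l = j := by simpa using hil
        dsimp only
        by_cases hi : i < 2 * n
        · rw [hr1 i hi, zero_mul]
        · have hl : l < 2 := by omega
          rw [hm_lt l hl, mul_zero]
      · rw [map_mul, Polynomial.coeff_mul]
        apply Finset.sum_eq_zero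
        rintro ⟨i, l⟩ hil
        have hil' : i + l = 2 * (n + 1) + 1 := by simpa using hil
        dsimp only
        by_cases hi : i < 2 * n
        · rw [hr1 i hi, zero_mul]
        · have hcases : l = 3 ∨ i = 2 * n + 1 ∨ l = 1 ∨ l = 0 := by omega
          rcases hcases with hl | hi' | hl | hl
          · rw [hl, hm3, mul_zero]
          · rw [hi', hr2, zero_mul]
          · rw [hl, hm_lt 1 (by norm_num), mul_zero]
          · rw [hl, hm_lt 0 (by norm_num), mul_zero]
    · intro x y hx hy
      refine ⟨fun j hj => ?_, ?_⟩
      · rw [map_add, Polynomial.coeff_add, hx.1 j hj, hy.1 j hj, add_zero]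
      · rw [map_add, Polynomial.coeff_add, hx.2, hy.2, add_zero]

/-- **The `x₂`-chart ring of `Bl_𝔭(Spec A)` embeds in `K[X]` without linear terms, hitting
`X²` and `X³`.** For `A ↪ K[X]` as above (`𝔭 = (x₂, x₅)` the origin), the chart ring
`C = (A[𝔭t])_{(x₂t)}` maps to `K[X]` by the universal property of the Rees algebra
(`exists_ringHom_reesAlgebra`, as `𝔭·K[X] = (X²)`); the map is injective (every element of `C`
is `a/x₂ᵐ` with `a ∈ 𝔭ᵐ`, and `x₂` becomes a unit in `A[1/x₂] ⊇ C`), its values have no linear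
term (the filtration bookkeeping), and `x₂/1 ↦ X²`, `x₅t/x₂t ↦ X³`.
[cite: GortzWedhorn2020, Prop. 13.92] -/
theorem exists_chart_ringHom {A : Type} [CommRing A] [IsDomain A]
    (ι : A →+* K[X]) (hι : Function.Injective ι)
    (hA : ∀ a : A, (ι a).coeff 1 = 0 ∧ (ι a).coeff 3 = 0)
    (x₂ x₅ : A) (hx₂ : ι x₂ = X ^ 2) (hx₅ : ι x₅ = X ^ 5)
    (𝔭 : Ideal A) (hgen : ∀ m ∈ 𝔭, ∃ b c : A, b * x₂ + c * x₅ = m) (hx₂𝔭 : x₂ ∈ 𝔭)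
    (hx₅𝔭 : x₅ ∈ 𝔭) :
    ∃ ι₀ : HomogeneousLocalization.Away (reesGrading 𝔭) (reesT x₂ hx₂𝔭) →+* K[X],
      Function.Injective ι₀ ∧ (∀ y, (ι₀ y).coeff 1 = 0) ∧
      ∃ x₂' x₃' : HomogeneousLocalization.Away (reesGrading 𝔭) (reesT x₂ hx₂𝔭),
        ι₀ x₂' = X ^ 2 ∧ ι₀ x₃' = X ^ 3 := by
  -- `𝔭 · K[X] = (X²)`
  have hIu : 𝔭.map ι = Ideal.span {(X ^ 2 : K[X])} := by
    apply le_antisymm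
    · rw [Ideal.map_le_iff_le_comap]
      intro a ha
      obtain ⟨b, c, hbc⟩ := hgen a ha
      rw [Ideal.mem_comap, Ideal.mem_span_singleton]
      refine ⟨ι b + ι c * X ^ 3, ?_⟩
      rw [← hbc, map_add, map_mul, map_mul, hx₂, hx₅]
      ring
    · rw [Ideal.span_singleton_le_iff_mem, ← hx₂]
      exact Ideal.mem_map_of_mem _ hx₂𝔭
  have hu : (X ^ 2 : K[X]) ∈ nonZeroDivisors K[X] :=
    mem_nonZeroDivisors_of_ne_zero (pow_ne_zero 2 X_ne_zero)
  obtain ⟨ψ, hψ0, hψ1, -⟩ := exists_ringHom_reesAlgebra hu hIu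
  -- `ψ (x₂ t) = 1`
  have hψ2 : ψ (reesT x₂ hx₂𝔭) = 1 := by
    have h := hψ1 x₂ hx₂𝔭
    rw [hx₂] at h
    exact mul_right_cancel₀ (pow_ne_zero 2 X_ne_zero) (h.trans (one_mul _).symm)
  have hunit : IsUnit (ψ (reesT x₂ hx₂𝔭)) := by rw [hψ2]; exact isUnit_one
  -- the map `C → A[𝔭t][1/x₂t] → K[X]`
  obtain ⟨ι₀, hι₀def⟩ : ∃ ι₀ : HomogeneousLocalization.Away (reesGrading 𝔭) (reesT x₂ hx₂𝔭) →+* K[X],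
      ι₀ = (IsLocalization.Away.lift (reesT x₂ hx₂𝔭) (g := ψ) hunit :
          Localization.Away (reesT x₂ hx₂𝔭) →+* K[X]).comp
        (algebraMap (HomogeneousLocalization.Away (reesGrading 𝔭) (reesT x₂ hx₂𝔭))
          (Localization.Away (reesT x₂ hx₂𝔭))) := ⟨_, rfl⟩
  -- values on `r/1`
  have hι0 : ∀ r, ι₀ (reesChartBase x₂ hx₂𝔭 r) = ι r := fun r => by
    rw [hι₀def]
    change IsLocalization.Away.lift (reesT x₂ hx₂𝔭) hunit (reesChartBase x₂ hx₂𝔭 r).val = _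
    rw [val_reesChartBase_eq_mk, Localization.mk_one_eq_algebraMap, IsLocalization.Away.lift_eq]
    exact hψ0 r
  -- normal form: `y · (x₂/1)^m = a/1` with `a ∈ 𝔭^m`, and its image `ι₀ y · X^{2m} = ι a`
  have hnf : ∀ y : HomogeneousLocalization.Away (reesGrading 𝔭) (reesT x₂ hx₂𝔭), ∃ (m : ℕ) (a : A),
      a ∈ 𝔭 ^ m ∧ y * reesChartBase x₂ hx₂𝔭 x₂ ^ m = reesChartBase x₂ hx₂𝔭 a ∧
        ι₀ y * (X ^ 2) ^ m = ι a := by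
    intro y
    obtain ⟨m, q, hq, rfl⟩ :=
      HomogeneousLocalization.Away.mk_surjective (reesGrading 𝔭) (reesT_mem x₂ hx₂𝔭) y
    obtain ⟨a, ha⟩ := hq
    have ha' : (q : A[X]) = monomial (m • 1) a := ha.symm
    have ham : a ∈ 𝔭 ^ m := by
      have h := (mem_reesAlgebra_iff (I := 𝔭) (q : A[X])).mp q.2 (m • 1)
      rw [ha', Polynomial.coeff_monomial, if_pos rfl, smul_eq_mul, mul_one] at h
      exact h
    have hy : HomogeneousLocalization.Away.mk (reesGrading 𝔭) (reesT_mem x₂ hx₂𝔭) m q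
          ⟨a, ha⟩ * reesChartBase x₂ hx₂𝔭 x₂ ^ m = reesChartBase x₂ hx₂𝔭 a := by
      apply HomogeneousLocalization.val_injective
      rw [HomogeneousLocalization.val_mul, HomogeneousLocalization.val_pow,
        HomogeneousLocalization.Away.val_mk, val_reesChartBase_eq_mk, val_reesChartBase_eq_mk,
        Localization.mk_pow, Localization.mk_mul, Localization.mk_eq_mk_iff,
        Localization.r_iff_exists]
      refine ⟨1, Subtype.ext ?_⟩
      simp only [OneMemClass.coe_one, one_mul, SubmonoidClass.coe_pow, Subalgebra.coe_mul,
        coe_reesT, ha', Subalgebra.coe_algebraMap, ← Polynomial.C_eq_algebraMap, monomial_pow,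
        monomial_mul_C, smul_eq_mul, mul_one, one_pow]
      rw [← C_pow, monomial_mul_C, mul_comm a]
    refine ⟨m, a, ham, hy, ?_⟩
    have h := congrArg ι₀ hy
    rwa [ι₀.map_mul, ι₀.map_pow, hι0, hι0, hx₂] at h
  refine ⟨ι₀, ?_, ?_, ?_⟩
  · -- injectivity: `ι₀ y = 0` forces `a = 0`, so `y · (x₂/1)^m = 0`; pass to `A[1/x₂]`
    rw [injective_iff_map_eq_zero]
    intro y hy
    obtain ⟨m, a, -, hya, h⟩ := hnf y
    rw [hy, zero_mul] at h
    have ha0 : a = 0 := hι (by rw [map_zero]; exact h.symm)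
    rw [ha0, map_zero] at hya
    apply reesChart_injective x₂ hx₂𝔭
    have h2 := congrArg (reesChart x₂ hx₂𝔭) hya
    rw [(reesChart x₂ hx₂𝔭).map_mul, (reesChart x₂ hx₂𝔭).map_pow, reesChart_reesChartBase,
      map_zero] at h2
    rw [map_zero]
    exact (IsUnit.mul_left_eq_zero ((IsLocalization.Away.algebraMap_isUnit x₂).pow m)).mp h2
  · -- no linear terms
    intro y
    obtain ⟨m, a, ham, -, h⟩ := hnf y
    have h1 : (ι₀ y * (X ^ 2) ^ m).coeff (1 + 2 * m) = (ι₀ y).coeff 1 := by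
      rw [← pow_mul, Polynomial.coeff_mul_X_pow]
    rw [← h1, h, add_comm]
    exact (coeff_eq_zero_of_mem_pow K ι hA x₂ x₅ hx₂ hx₅ 𝔭 hgen m a ham).2
  · -- `x₂/1 ↦ X²` and `x₅t/x₂t ↦ X³`
    have h5deg : reesT x₅ hx₅𝔭 ∈ reesGrading 𝔭 (1 • 1) := by
      simpa using reesT_mem x₅ hx₅𝔭
    refine ⟨reesChartBase x₂ hx₂𝔭 x₂,
      HomogeneousLocalization.Away.mk (reesGrading 𝔭) (reesT_mem x₂ hx₂𝔭) 1 (reesT x₅ hx₅𝔭) h5deg,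
      (hι0 _).trans hx₂, ?_⟩
    have heq : HomogeneousLocalization.Away.mk (reesGrading 𝔭) (reesT_mem x₂ hx₂𝔭) 1
          (reesT x₅ hx₅𝔭) h5deg * reesChartBase x₂ hx₂𝔭 x₂ = reesChartBase x₂ hx₂𝔭 x₅ := by
      apply reesChart_injective x₂ hx₂𝔭
      rw [map_mul, reesChart_reesChartBase, reesChart_reesChartBase]
      have h := reesChart_mk_mul_pow x₂ hx₂𝔭 1 (reesT x₅ hx₅𝔭) h5deg
      rw [pow_one, reesEval_of_eq_monomial x₂ (coe_reesT x₅ hx₅𝔭)] at h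
      exact h
    have h := congrArg ι₀ heq
    rw [ι₀.map_mul, hι0, hι0, hx₂, hx₅] at h
    have h' : ι₀ (HomogeneousLocalization.Away.mk (reesGrading 𝔭) (reesT_mem x₂ hx₂𝔭) 1
        (reesT x₅ hx₅𝔭) h5deg) * X ^ 2 = X ^ 3 * X ^ 2 := by rw [h]; ring
    exact mul_right_cancel₀ (pow_ne_zero 2 X_ne_zero) h'

end Charts

end Summit.ResolutionOfSingularities.ResolutionOfSingularities.Theorems.AffineToGlobal.Negative

end
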